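import Summits.QuantumFields.GaugeBoot.TiltedLatticeGauge
import HarnessLib

/-!
# The one-link Haar-shift (Gibbs) identity of the Wilson measure on a periodic lattice (gauge-boot, L3(υ) supplement)

HONEST FRAMING (cell `pub-gaugeboot`, page 1 of every file): the venture produces certified bounds
on lattice expectations at stated coupling, gauge group, dimension and torus size; NOT a mass gap,
NOT a continuum limit, NOT a string tension; NOT Yang–Mills-summit-bearing (barriers
`FixedCouplingUltralocality`, `PerturbativeInvisibility`).

The first input of the lattice bootstrap (Kazakov–Zheng arXiv:2203.11360 §2: loop equations; §3:
positivity, symmetries) in the periodic-lattice setting of `TiltedLatticeGauge.lean` (finite additive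
commutative site group `A`, marked translations `e : Fin d → A`; the cubic torus and the 45°-tilted
box of `TiltedBox.lean` are instances): the **one-link Haar-shift identity** of the Wilson
probability measure `μ_β = gibbs ρ e β`,

  `∫ f(U[l ↦ g U_l]) dμ_β(U) = ∫ f(U) · exp(-β (S(U[l ↦ g⁻¹ U_l]) - S(U))) dμ_β(U)`

for every link `l`, every `g ∈ G` and every `f : Config A d G → ℝ` (`integral_comp_update_mul_gibbs`;
compact `G`, every representation `ρ`, every real `β`). This is the periodic-lattice form of the tree's torus
theorem `haarShift_wilsonExpectation` and of the axiom `IsHaarShiftState` of `ClassB.lean`; it says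
that the conditional law of one link variable given the others is Haar measure tilted by the
Boltzmann weight of the plaquettes containing the link, and its derivative along one-parameter
subgroups `g = exp(tX)` is the single-link Schwinger–Dyson identity from which the loop equations
on the periodic lattice are read off (Cao–Park–Sheffield, Comm. AMS 5 (2025), Thm. 5.7 / Thm. 6.104, for any
finite graph; the tree's word calculus `LatticeWords.lean` ff. is typed for the cubic torus).
Proof: the shift `U ↦ U[l ↦ g U_l]` is a measurable bijection preserving the product Haar measure
(left invariance of Haar measure in the factor `l`); change variables in the Gibbs average and let
the Boltzmann factors telescope.

References: V. Kazakov, Z. Zheng, arXiv:2203.11360 §2; S. Cao, M. Park, S. Sheffield, Comm. AMS 5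
(2025) Thm. 5.7 (`U(N)`) / Thm. 6.104 (`SU(N)`) (arXiv:2307.06790 numbering; informally Thm. 1.14);
H.-O. Georgii, Gibbs Measures and Phase Transitions (2011) Def. 2.9.
-/

noncomputable section

open MeasureTheory
open Literature.MathematicalPhysics.QuantumFieldTheory (haarProbability)
open Literature.RepresentationTheory.CompactGroups

namespace Summit.QuantumFields.GaugeBoot

namespace TiltedRP

variable {A : Type*} [DecidableEq A] {d N : ℕ} {G : Type*} [Group G]

/-- `(U[l ↦ g U_l])[l ↦ g⁻¹ (U[l ↦ g U_l])_l] = U`: the shift by `g⁻¹` undoes the shift by `g`. -/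
theorem update_inv_mul_update_mul (l : Link A d) (g : G) (U : Config A d G) :
    Function.update (Function.update U l (g * U l)) l
      (g⁻¹ * Function.update U l (g * U l) l) = U := by
  funext l'
  by_cases hl : l' = l
  · subst hl
    simp
  · simp [hl]

variable [TopologicalSpace G] [IsTopologicalGroup G] [MeasurableSpace G] [BorelSpace G]

/-- The one-link shift `U ↦ U[l ↦ g U_l]` is measurable. -/
theorem measurable_update_mul (l : Link A d) (g : G) :
    Measurable fun U : Config A d G => Function.update U l (g * U l) := by
  refine measurable_pi_lambda _ fun l' => ?_
  by_cases hl : l' = l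
  · subst hl
    simp only [Function.update_self]
    exact ((measurable_pi_apply l' : Measurable fun U : Config A d G => U l')).const_mul g
  · simp only [Function.update_of_ne hl]
    exact measurable_pi_apply l'

variable [CompactSpace G] [Fintype A]

/-- **The one-link shift preserves the product Haar measure** (left invariance of the Haar
probability measure in the factor `l`). -/
theorem measurePreserving_update_mul (l : Link A d) (g : G) :
    MeasurePreserving (fun U : Config A d G => Function.update U l (g * U l))
      (productHaar A d G) (productHaar A d G) := by
  classical
  haveI : IsProbabilityMeasure (haarProbability G) :=
    CompactGroup.isProbabilityMeasure_haarMeasure_top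
  haveI : (haarProbability G).IsMulLeftInvariant := by
    unfold haarProbability; infer_instance
  have key := measurePreserving_pi (fun _ : Link A d => haarProbability G)
    (fun _ : Link A d => haarProbability G)
    (f := fun l' (x : G) => if l' = l then g * x else x) (fun l' => by
      by_cases hl : l' = l
      · simp only [hl, ↓reduceIte]
        exact measurePreserving_mul_left (haarProbability G) g
      · simp only [hl, ↓reduceIte]
        exact MeasurePreserving.id _)
  have hfun : (fun (a : Config A d G) (l' : Link A d) => if l' = l then g * a l' else a l') =
      fun U => Function.update U l (g * U l) := by
    funext U l'
    by_cases hl : l' = l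
    · subst hl; simp
    · simp [hl]
  unfold productHaar
  rw [hfun] at key
  exact key

variable [AddCommGroup A] (ρ : G →* Matrix (Fin N) (Fin N) ℂ)

omit [TopologicalSpace G] [IsTopologicalGroup G] [MeasurableSpace G] [BorelSpace G] [CompactSpace G]
  [Fintype A] [AddCommGroup A] in
/-- The one-link shift as a measurable bijection of configurations (inverse: the shift by `g⁻¹`). -/
theorem update_mul_update_inv_mul (l : Link A d) (g : G) (U : Config A d G) :
    Function.update (Function.update U l (g⁻¹ * U l)) l
      (g * Function.update U l (g⁻¹ * U l) l) = U := by
  have h := update_inv_mul_update_mul l g⁻¹ U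
  rwa [inv_inv] at h

/-- **The one-link Haar-shift (Gibbs) identity of the Wilson measure of a periodic lattice**:
`∫ f(U[l ↦ g U_l]) dμ_β = ∫ f(U) exp(-β (S(U[l ↦ g⁻¹ U_l]) - S(U))) dμ_β` for every link `l`,
`g ∈ G`, `f : Config A d G → ℝ` (compact `G`, every `ρ`, every real `β`). -/
theorem integral_comp_update_mul_gibbs (e : Fin d → A) (β : ℝ) (l : Link A d)
    (g : G) (f : Config A d G → ℝ) :
    ∫ U, f (Function.update U l (g * U l)) ∂(gibbs ρ e β) =
      ∫ U, f U * Real.exp (-(β * (wilsonAction ρ e (Function.update U l (g⁻¹ * U l)) -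
        wilsonAction ρ e U))) ∂(gibbs ρ e β) := by
  rw [integral_gibbs, integral_gibbs]
  set Z := ∫ U, Real.exp (-β * wilsonAction ρ e U) ∂(productHaar A d G) with hZ
  let T : Config A d G ≃ᵐ Config A d G :=
    { toFun := fun U => Function.update U l (g * U l)
      invFun := fun U => Function.update U l (g⁻¹ * U l)
      left_inv := fun U => update_inv_mul_update_mul l g U
      right_inv := fun U => update_mul_update_inv_mul l g U
      measurable_toFun := measurable_update_mul l g
      measurable_invFun := measurable_update_mul l g⁻¹ }
  have hT : MeasurePreserving T (productHaar A d G) (productHaar A d G) :=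
    measurePreserving_update_mul l g
  have hcv := hT.integral_comp' (fun V : Config A d G => (Real.exp (-β * wilsonAction ρ e V) / Z) •
    (f V * Real.exp (-(β * (wilsonAction ρ e (Function.update V l (g⁻¹ * V l)) -
      wilsonAction ρ e V)))))
  rw [← hcv]
  refine integral_congr_ae (ae_of_all _ fun U => ?_)
  show (Real.exp (-β * wilsonAction ρ e U) / Z) • f (Function.update U l (g * U l)) =
    (Real.exp (-β * wilsonAction ρ e (Function.update U l (g * U l))) / Z) •
      (f (Function.update U l (g * U l)) * Real.exp (-(β *
        (wilsonAction ρ e (Function.update (Function.update U l (g * U l)) l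
          (g⁻¹ * Function.update U l (g * U l) l)) -
          wilsonAction ρ e (Function.update U l (g * U l))))))
  rw [update_inv_mul_update_mul]
  set S₀ := wilsonAction ρ e U
  set S₁ := wilsonAction ρ e (Function.update U l (g * U l))
  have hexp : Real.exp (-β * S₁) * Real.exp (-(β * (S₀ - S₁))) = Real.exp (-β * S₀) := by
    rw [← Real.exp_add]
    congr 1
    ring
  simp only [smul_eq_mul]
  rw [← hexp]
  ring

/-- The same identity for the expectation of a function of the shifted configuration against a
test function: `∫ f(U[l ↦ g U_l]) k(U) dμ_β = ∫ f(U) k(U[l ↦ g⁻¹ U_l]) exp(-β (S(U[l ↦ g⁻¹ U_l]) - S(U))) dμ_β`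
(apply the identity to `U ↦ f(U[l ↦ g U_l]) k(U)` rewritten as a function of the shifted
configuration). -/
theorem integral_comp_update_mul_mul_gibbs (e : Fin d → A) (β : ℝ) (l : Link A d) (g : G)
    (f k' : Config A d G → ℝ) :
    ∫ U, f (Function.update U l (g * U l)) * k' U ∂(gibbs ρ e β) =
      ∫ U, f U * k' (Function.update U l (g⁻¹ * U l)) *
        Real.exp (-(β * (wilsonAction ρ e (Function.update U l (g⁻¹ * U l)) -
          wilsonAction ρ e U))) ∂(gibbs ρ e β) := by
  have h := integral_comp_update_mul_gibbs ρ e β l g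
    (fun V => f V * k' (Function.update V l (g⁻¹ * V l)))
  simp only [update_inv_mul_update_mul] at h
  exact h

end TiltedRP

end Summit.QuantumFields.GaugeBoot
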